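import Summits.CriticalPhenomena.PercolationContinuityZ3.Theorems.PercNearOneGluingNoHeavyQuantGluedTwoColDual
import Summits.CriticalPhenomena.PercolationContinuityZ3.Theorems.PercNearOneGluingNoHeavyQuantGluedWindowLight
import HarnessLib

/-!
# QUANT lane R8, T-DEC: LEMMA W's pair condition in the two-row regime — FIRST h-LOW CELL: the two lower copies of the low atom cannot pair with its
# top copy, the high atom is low and light into it; two columns, NO cheapness (arm-1 gen 59, architect)

builds on p205010 (kernel theorem, internal audit signed; external expert review pending)

Support file (`--supports stmt-CriticalPhenomena-4575`), QUANT lane seat prim-quant-arm-1 (gen 59); memo `run/shared/lean/prim/quant/prim-quant-arm-1-g59/ARCH-G59.md`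
§7.  Theorems only; standard axioms, no sorries, no definitions.  The two-row regime of LEMMA W (`2(l+r) < T ≤ 2(l+r+k)`, `l+r+k ≤ j`) splits by the status of
`h`; when `h` is LOW for the glued target `T` the survey (kit j297905) says the column `L2 = l+r+k` and the giants at the floor rate suffice — no cheap atom.  This
file proves the cell in which `l` and `l+r` are INCOMPATIBLE with `L2` (`2l + 2r + k ≤ T`) and `h` is LIGHT into `L2` (`T − 2h ≤ y(L2 − h)`), for either status
of `h+r` (**`gluedPullback_windowPair_twoRow_farLight`**): the rows `l, l+r` ride the giant `h+r+k`; the rows `h` (and `h+r` when low) are shared between `L2`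
and the giant by the order-free two-column criterion `GluedWindow.twoCol_dual_three` (`…QuantGluedTwoColDual`), whose two kink checks hold piecewise
(`(t₀+t₁)κ ≤ t₂` for a light rate `κ`, `(t₀+t₁)u ≤ t₂`), and whose pool capacity `E = γt₂ − (1−γ)(t₀+t₁)u` is positive because the cell forces
`ρ₀ > 2(1−y)`, hence `γ = y² + (1−y)ρ₀ ≥ 3(y−2/3)² + 2/3`.

HONEST STATUS.  `GluedLemmaW` (flow form), `GluedDominatedMass`, the band, `SiblingStep`, `FarTreeRow` OPEN; RATE class (log\*) / honest sentence of
`run/shared/lean/prim/quant/README.md` unchanged.  [this work].  Nothing here is cited as a published result.  The gluing rows served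
[cite: KozmaNitzan2024, Conjecture 3 (p. 15)]; product measure [cite: Grimmett1999, §1.3 p. 10].
-/

set_option maxHeartbeats 1600000

noncomputable section

open scoped BigOperators

namespace Summit.CriticalPhenomena.PercolationContinuityZ3.Theorems
namespace Quant

open Finset

namespace LawDec

/-- **TWO-ROW REGIME, CELL "far & light"**: `l+r+k ≤ j` a mid for the glued target (`T ≤ 2(l+r+k)`), its two lower copies incompatible with it
(`2l + 2r + k ≤ T`), `h` low (`2h < T`) and light into `l+r+k` (`T − 2h ≤ y·(l+r+k−h)`).  Then for EVERY price system `(α, p)` at `(y, T, j)`: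
`(1−γ)Ψ(l) + γΨ(h) ≤ 0` — without any cheap atom. [this work] -/
theorem gluedPullback_windowPair_twoRow_farLight (x a q g S : ℝ) (B r k j l h : ℕ) (α p : ℕ → ℝ)
    (hx0 : 0 < x) (hx1 : x < 1) (ha0 : 0 < a) (ha1 : a ≤ 1) (hq0 : 0 < q) (hq1 : q < 1) (hg1 : g ≤ 1) (hk : 1 ≤ k)
    (hxqg : x ≤ q * g) (hband2 : q * ((r : ℝ) + k * g) - r < (k : ℝ) * x)
    (hlh : l < h) (hhB : h ≤ B) (hhj : h ≤ j) (hwin : j < h + r + k) (hlow : 2 * (l : ℝ) < a * S) (hcomp : a * S < (l : ℝ) + h)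
    (hlight : pairGate (a * x) (a * S) l h < a * x)
    (hL2j : l + r + k ≤ j) (hL2mid : a * (S + q * ((r : ℝ) + k * g)) ≤ 2 * ((l : ℝ) + r + k))
    (hinc : 2 * (l : ℝ) + 2 * r + k ≤ a * (S + q * ((r : ℝ) + k * g))) (hhlow : 2 * (h : ℝ) < a * (S + q * ((r : ℝ) + k * g)))
    (hhlight : a * (S + q * ((r : ℝ) + k * g)) - 2 * (h : ℝ) ≤ (a * x) * ((l : ℝ) + r + k - h))
    (hp : ∀ h, 0 ≤ p h)
    (hαp : ∀ l' h', l' ≤ j → 2 * (l' : ℝ) < a * (S + q * ((r : ℝ) + k * g)) → h' ≤ B + (r + k) →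
      (j + 1 ≤ h' ∨ a * (S + q * ((r : ℝ) + k * g)) < (l' : ℝ) + h') →
      α l' ≤ usage (a * x) (a * (S + q * ((r : ℝ) + k * g))) j l' h' * p h') :
    (1 - pairGate (a * x) (a * S) l h) * gluedPullback (a * (S + q * ((r : ℝ) + k * g))) q g j r k α p l
      + pairGate (a * x) (a * S) l h * gluedPullback (a * (S + q * ((r : ℝ) + k * g))) q g j r k α p h ≤ 0 := by
  set y : ℝ := a * x with hy
  set T : ℝ := a * (S + q * ((r : ℝ) + k * g)) with hT
  set T₀ : ℝ := a * S with hT₀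
  set t0 : ℝ := 1 - q with ht0
  set t1 : ℝ := q * (1 - g) with ht1
  set t2 : ℝ := q * g with ht2
  clear_value y T T₀ t0 t1 t2
  have hy0 : 0 < y := by rw [hy]; exact mul_pos ha0 hx0
  have hyx : y ≤ x := by rw [hy]; nlinarith
  have hy1 : y < 1 := by linarith
  have h1y : 0 < 1 - y := by linarith
  have hu0 : 0 ≤ y / (1 - y) := div_nonneg hy0.le h1y.le
  have hyt2 : y ≤ t2 := by rw [ht2]; linarith
  have ht0p : 0 ≤ t0 := by rw [ht0]; linarith
  have ht1p : 0 ≤ t1 := by rw [ht1]; exact mul_nonneg hq0.le (by linarith)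
  have ht2p : 0 ≤ t2 := by linarith
  have hts : t0 + t1 + t2 = 1 := by rw [ht0, ht1, ht2]; ring
  have ht21 : t2 ≤ 1 := by linarith
  have hr0 : (0:ℝ) ≤ r := Nat.cast_nonneg r
  have hk0 : (0:ℝ) ≤ k := Nat.cast_nonneg k
  -- T − T₀ = a·(q r + t2 k) =: A
  have hA : T - T₀ = a * (q * (r : ℝ) + t2 * k) := by rw [hT, hT₀, ht2]; ring
  have hA0 : 0 ≤ a * (q * (r : ℝ) + t2 * k) := mul_nonneg ha0.le (by positivity)
  have hAK : a * (q * (r : ℝ) + t2 * k) ≤ (r : ℝ) + k := by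
    have h1 : q * (r : ℝ) + t2 * k ≤ (r : ℝ) + k := by nlinarith [mul_le_mul_of_nonneg_right hq1.le hr0, mul_le_mul_of_nonneg_right ht21 hk0]
    have h2 : a * (q * (r : ℝ) + t2 * k) ≤ 1 * (q * (r : ℝ) + t2 * k) := mul_le_mul_of_nonneg_right ha1 (by positivity)
    linarith
  -- band2 scaled by a: a t2 k < k y + a t0 r
  have hband2a : a * (t2 * (k : ℝ)) < (k : ℝ) * y + a * (t0 * r) := by
    have e1 : q * ((r : ℝ) + k * g) - r = t2 * k - t0 * r := by rw [ht2, ht0]; ring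
    rw [e1] at hband2
    have := mul_lt_mul_of_pos_left hband2 ha0
    have e2 : a * ((k : ℝ) * x) = (k : ℝ) * y := by rw [hy]; ring
    linarith [this, e2]
  have hlh' : (l : ℝ) < h := by exact_mod_cast hlh
  have hd0 : (0:ℝ) < (h : ℝ) - l := by linarith
  -- the light gate γ = y² + (1−y)ρ₀ and the cell's lower bound ρ₀ > 2(1−y)
  obtain ⟨ρ₀, hρ₀⟩ : ∃ ρ₀ : ℝ, ρ₀ = (T₀ - 2 * (l : ℝ)) / ((h : ℝ) - l) := ⟨_, rfl⟩
  have hρ₀y : ρ₀ < y := by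
    have : (T₀ - 2 * (l : ℝ)) / ((h : ℝ) - l) ≤ pairGate y T₀ l h := le_max_left _ _
    rw [hρ₀]; linarith
  have hρ₀0 : 0 < ρ₀ := by rw [hρ₀]; exact div_pos (by linarith) hd0
  have hγ : pairGate y T₀ l h = y ^ 2 + (1 - y) * ρ₀ := by
    rw [hρ₀]; exact pairGate_eq_light y T₀ l h hy0.le (by rw [← hρ₀]; exact hρ₀y.le)
  have eT₀ : T₀ - 2 * (l : ℝ) = ρ₀ * ((h : ℝ) - l) := by rw [hρ₀]; field_simp
  set d : ℝ := (h : ℝ) - l with hd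
  -- (B): d(2 − ρ₀) < A;  (A): 2r + k ≤ ρ₀ d + A
  have hB : d * (2 - ρ₀) < a * (q * (r : ℝ) + t2 * k) := by
    have : 2 * (h : ℝ) < 2 * (l : ℝ) + ρ₀ * d + a * (q * (r : ℝ) + t2 * k) := by linarith [hA, eT₀]
    rw [hd]; nlinarith [this]
  have hAr : 2 * (r : ℝ) + k ≤ ρ₀ * d + a * (q * (r : ℝ) + t2 * k) := by linarith [hA, eT₀]
  have h2ρ : 0 < 2 - ρ₀ := by linarith
  have hE1 : (2 * (r : ℝ) + k) * (2 - ρ₀) < 2 * (a * (q * (r : ℝ) + t2 * k)) := by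
    have s1 : (2 * (r : ℝ) + k - a * (q * (r : ℝ) + t2 * k)) * (2 - ρ₀) ≤ ρ₀ * d * (2 - ρ₀) := by
      exact mul_le_mul_of_nonneg_right (by linarith) h2ρ.le
    have s2 : ρ₀ * d * (2 - ρ₀) < ρ₀ * (a * (q * (r : ℝ) + t2 * k)) := by
      have := mul_lt_mul_of_pos_left hB hρ₀0
      linarith [this]
    nlinarith [s1, s2]
  have hρ₀low : 2 * (1 - y) < ρ₀ := by
    -- A = aqr + a t2 k < a r + k y (band2), a ≤ 1
    have hA' : a * (q * (r : ℝ) + t2 * k) < (k : ℝ) * y + a * r := by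
      have e : a * (q * (r : ℝ) + t2 * k) = a * q * r + a * (t2 * k) := by ring
      have e2 : a * (t0 * (r : ℝ)) = a * r - a * q * r := by rw [ht0]; ring
      linarith [hband2a]
    have hk1 : (1:ℝ) ≤ k := by exact_mod_cast hk
    have hkpos : (0:ℝ) < k := by linarith
    -- k(2 − ρ₀) < 2ky, since 2r(2 − a − ρ₀) ≥ 0
    have hpos : 0 ≤ 2 * (r : ℝ) * (2 - a - ρ₀) := mul_nonneg (by positivity) (by linarith)
    have e1 : (2 * (r : ℝ) + k) * (2 - ρ₀) = 4 * r + 2 * k - 2 * ((r : ℝ) * ρ₀) - (k : ℝ) * ρ₀ := by ring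
    have e2 : 2 * (r : ℝ) * (2 - a - ρ₀) = 4 * r - 2 * (a * r) - 2 * ((r : ℝ) * ρ₀) := by ring
    have key : (k : ℝ) * (2 - ρ₀) < (k : ℝ) * (2 * y) := by
      have e3 : (k : ℝ) * (2 - ρ₀) = 2 * k - (k : ℝ) * ρ₀ := by ring
      rw [e3]; rw [e1] at hE1; rw [e2] at hpos
      linarith
    have := lt_of_mul_lt_mul_left key hkpos.le
    linarith
  have hγ23 : 2 / 3 ≤ y ^ 2 + (1 - y) * ρ₀ := by
    nlinarith [mul_le_mul_of_nonneg_left hρ₀low.le h1y.le, sq_nonneg (y - 2 / 3)]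
  obtain ⟨γ, hγdef⟩ : ∃ γ : ℝ, γ = y ^ 2 + (1 - y) * ρ₀ := ⟨_, rfl⟩
  have hγ' : pairGate y T₀ l h = γ := by rw [hγ, hγdef]
  have hγ0 : 0 ≤ γ := by rw [hγdef]; nlinarith [mul_nonneg h1y.le hρ₀0.le, sq_nonneg y]
  have hγ1 : γ ≤ 1 := by rw [hγdef]; nlinarith [mul_le_mul_of_nonneg_left hρ₀y.le h1y.le]
  have h1γ : 0 ≤ 1 - γ := by linarith
  have h2γ : 0 ≤ 2 * γ - 1 := by rw [hγdef]; linarith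
  -- the pool capacity left after the rows l, l+r: E = γ t2 − (1−γ)(t0+t1) u ≥ 0
  obtain ⟨E, hE⟩ : ∃ E : ℝ, E = γ * t2 - (1 - γ) * (t0 + t1) * (y / (1 - y)) := ⟨_, rfl⟩
  have et01 : t0 + t1 = 1 - t2 := by linarith
  have hE0 : 0 ≤ E := by
    have e1 : E * (1 - y) = γ * t2 * (1 - y) - (1 - γ) * (1 - t2) * y := by
      rw [hE, et01]; field_simp
    have a1 : γ * y * (1 - y) ≤ γ * t2 * (1 - y) := mul_le_mul_of_nonneg_right (mul_le_mul_of_nonneg_left hyt2 hγ0) h1y.le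
    have a2 : (1 - γ) * (1 - t2) * y ≤ (1 - γ) * (1 - y) * y :=
      mul_le_mul_of_nonneg_right (mul_le_mul_of_nonneg_left (by linarith : 1 - t2 ≤ 1 - y) h1γ) hy0.le
    have a3 : 0 ≤ y * (1 - y) * (2 * γ - 1) := mul_nonneg (mul_nonneg hy0.le h1y.le) h2γ
    have e3 : γ * t2 * (1 - y) - (1 - γ) * (1 - t2) * y - y * (1 - y) * (2 * γ - 1)
        = (γ * t2 * (1 - y) - γ * y * (1 - y)) + ((1 - γ) * (1 - y) * y - (1 - γ) * (1 - t2) * y) := by ring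
    have h3 : 0 ≤ E * (1 - y) := by rw [e1]; linarith [a1, a2, a3, e3]
    by_contra hneg
    have : E * (1 - y) < 0 := mul_neg_of_neg_of_pos (not_le.mp hneg) h1y
    linarith
  -- (t0 + t1) u ≤ t2
  have hut : (t0 + t1) * (y / (1 - y)) ≤ t2 := by
    rw [← mul_div_assoc, div_le_iff₀ h1y, et01]
    nlinarith [mul_le_mul_of_nonneg_left hyt2 (show (0:ℝ) ≤ 1 - t2 by linarith)]
  -- the kink check for a light A-row with rate κ': γ(t0+t1)uκ' ≤ (1−γ)t2 u + E κ'
  have kink : ∀ κ' : ℝ, 0 ≤ κ' → (t0 + t1) * κ' ≤ t2 →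
      γ * (t0 + t1) * (y / (1 - y)) * κ' ≤ (1 - γ) * t2 * (y / (1 - y)) + E * κ' := by
    intro κ' hκ0 hκt
    have p1 : 0 ≤ (1 - γ) * (y / (1 - y)) * (t2 - (t0 + t1) * κ') := mul_nonneg (mul_nonneg h1γ hu0) (by linarith only [hκt])
    have p2 : 0 ≤ γ * κ' * (t2 - (t0 + t1) * (y / (1 - y))) := mul_nonneg (mul_nonneg hγ0 hκ0) (by linarith only [hut])
    have e : (1 - γ) * t2 * (y / (1 - y)) + E * κ' - γ * (t0 + t1) * (y / (1 - y)) * κ'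
        = (1 - γ) * (y / (1 - y)) * (t2 - (t0 + t1) * κ') + γ * κ' * (t2 - (t0 + t1) * (y / (1 - y))) := by rw [hE]; ring
    linarith only [p1, p2, e]
  -- low / non-low statuses
  have hTlt : T < (h : ℝ) + ((l : ℝ) + r + k) := by
    have : T ≤ T₀ + ((r : ℝ) + k) := by linarith [hA, hAK]
    linarith
  have hL0 : l ≤ j ∧ 2 * (l : ℝ) < T := ⟨by omega, by linarith⟩
  have hL1 : l + r ≤ j ∧ 2 * ((l + r : ℕ) : ℝ) < T := ⟨by omega, by push_cast; linarith⟩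
  have hL2n : ¬ (l + r + k ≤ j ∧ 2 * ((l + r + k : ℕ) : ℝ) < T) := by push_cast; intro hh; linarith [hh.2]
  have hH0 : h ≤ j ∧ 2 * (h : ℝ) < T := ⟨hhj, hhlow⟩
  have hH2n : ¬ (h + r + k ≤ j ∧ 2 * ((h + r + k : ℕ) : ℝ) < T) := fun hh => absurd hh.1 (by omega)
  have cL : ∀ v : ℕ, (v ≤ j ∧ 2 * (v : ℝ) < T) → coefAt T j α p v = α v := fun v hv => by simp only [coefAt, if_pos hv]
  have cN : ∀ v : ℕ, ¬ (v ≤ j ∧ 2 * (v : ℝ) < T) → coefAt T j α p v = -p v := fun v hv => by simp only [coefAt, if_neg hv]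
  have eΨl : gluedPullback T q g j r k α p l = t0 * α l + t1 * α (l + r) - t2 * p (l + r + k) := by
    simp only [gluedPullback, cL l hL0, cL (l + r) hL1, cN (l + r + k) hL2n, ht0, ht1, ht2]; ring
  have eΨh : gluedPullback T q g j r k α p h = t0 * α h + t1 * coefAt T j α p (h + r) - t2 * p (h + r + k) := by
    simp only [gluedPullback, cL h hH0, cN (h + r + k) hH2n, ht0, ht1, ht2]; ring
  -- prices: pA = p(L2), P = p(H2); u = y/(1−y)
  set pA : ℝ := p (l + r + k) with hpA
  set P : ℝ := p (h + r + k) with hP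
  have hpA0 : 0 ≤ pA := hp _
  have hP0 : 0 ≤ P := hp _
  have hH2M : h + r + k ≤ B + (r + k) := by omega
  have hL2M : l + r + k ≤ B + (r + k) := by omega
  have giant : ∀ w : ℕ, w ≤ j → 2 * (w : ℝ) < T → α w ≤ y / (1 - y) * P := by
    intro w hwj hwl
    have := hαp w (h + r + k) hwj hwl hH2M (Or.inl (by omega))
    rwa [usage_giant_eq y T j w (h + r + k) (by omega)] at this
  have bl := giant l hL0.1 hL0.2
  have bL1 := giant (l + r) hL1.1 hL1.2
  have bh := giant h hhj hhlow
  -- the light rate of a low row w ≥ h into L2: κ_w = G/(1−G), G = y² + (1−y)ρ_w ≤ y ≤ t2, so (t0+t1)κ_w ≤ t2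
  have hL2r : ((l + r + k : ℕ) : ℝ) = (l : ℝ) + r + k := by push_cast; ring
  have rowA : ∀ w : ℕ, h ≤ w → w ≤ j → 2 * (w : ℝ) < T →
      ∃ κ : ℝ, 0 ≤ κ ∧ (t0 + t1) * κ ≤ t2 ∧ α w ≤ κ * pA ∧ α w ≤ y / (1 - y) * P := by
    intro w hhw hwj hwl
    have hw' : (h : ℝ) ≤ w := by exact_mod_cast hhw
    have hwL2 : (w : ℝ) < (l : ℝ) + r + k := by linarith only [hwl, hL2mid]
    have hdw : (0:ℝ) < ((l + r + k : ℕ) : ℝ) - w := by rw [hL2r]; linarith only [hwL2]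
    have hcompw : T < (w : ℝ) + ((l + r + k : ℕ) : ℝ) := by rw [hL2r]; linarith only [hTlt, hw']
    have hdh : (0:ℝ) < (l : ℝ) + r + k - h := by linarith only [hhlow, hL2mid]
    have hρh : (T - 2 * (h : ℝ)) / ((l : ℝ) + r + k - h) ≤ y := by rw [div_le_iff₀ hdh]; exact hhlight
    obtain ⟨ρ, hρ⟩ : ∃ ρ : ℝ, ρ = (T - 2 * (w : ℝ)) / (((l + r + k : ℕ) : ℝ) - w) := ⟨_, rfl⟩
    have hρw : ρ ≤ y := by
      refine le_trans ?_ hρh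
      rw [hρ, hL2r]
      exact ratio_anti_low T (h : ℝ) (w : ℝ) ((l : ℝ) + r + k) hw' hwL2 hL2mid
    have hρw0 : 0 ≤ ρ := by rw [hρ]; exact div_nonneg (by linarith only [hwl]) hdw.le
    have eκ : usage y T j w (l + r + k) = (y ^ 2 + (1 - y) * ρ) / (1 - (y ^ 2 + (1 - y) * ρ)) := by
      rw [hρ]; exact usage_light_eq y T j w (l + r + k) hy0.le hL2j (by rw [← hρ]; exact hρw)
    have hG : y ^ 2 + (1 - y) * ρ ≤ y := by
      have := mul_le_mul_of_nonneg_left hρw h1y.le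
      nlinarith only [this]
    have hG0 : 0 ≤ y ^ 2 + (1 - y) * ρ := add_nonneg (sq_nonneg y) (mul_nonneg h1y.le hρw0)
    have hG1 : 0 < 1 - (y ^ 2 + (1 - y) * ρ) := by linarith only [hG, hy1]
    refine ⟨usage y T j w (l + r + k), ?_, ?_, ?_, giant w hwj hwl⟩
    · rw [eκ]; exact div_nonneg hG0 hG1.le
    · rw [eκ, ← mul_div_assoc, div_le_iff₀ hG1, et01]
      nlinarith only [hG, hyt2, hG0, ht21]
    · exact hαp w (l + r + k) hwj hwl hL2M (Or.inr hcompw)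
  -- row h
  obtain ⟨κh, hκh0, hκht, bhA, _⟩ := rowA h le_rfl hhj hhlow
  -- assemble: (1−γ)(t0 αl + t1 αL1) ≤ (1−γ)(t0+t1) u P
  have low2 : (1 - γ) * (t0 * α l + t1 * α (l + r)) ≤ (1 - γ) * (t0 + t1) * (y / (1 - y)) * P := by
    have h1 := add_le_add (mul_le_mul_of_nonneg_left bl ht0p) (mul_le_mul_of_nonneg_left bL1 ht1p)
    have h2 := mul_le_mul_of_nonneg_left h1 h1γ
    have e : (1 - γ) * (t0 * (y / (1 - y) * P) + t1 * (y / (1 - y) * P)) = (1 - γ) * (t0 + t1) * (y / (1 - y)) * P := by ring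
    linarith only [h2, e]
  rw [hγ', eΨl, eΨh]
  by_cases hH1 : h + r ≤ j ∧ 2 * ((h + r : ℕ) : ℝ) < T
  · -- h + r low: second A-row
    rw [cL (h + r) hH1]
    obtain ⟨κ1, hκ10, hκ1t, b1A, b1P⟩ := rowA (h + r) (by omega) hH1.1 hH1.2
    have two := GluedWindow.twoCol_dual_three (γ * t0) (γ * t1) 0 κh κ1 0 (y / (1 - y)) (y / (1 - y)) 0 (α h) (α (h + r)) 0
      ((1 - γ) * t2) E pA P (mul_nonneg hγ0 ht0p) (mul_nonneg hγ0 ht1p) le_rfl hκh0 hκ10 le_rfl hu0 hu0 le_rfl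
      (mul_nonneg h1γ ht2p) hE0 hpA0 hP0 bhA b1A (by simp) bh b1P (by simp) ?_ ?_ ?_
    · have eL : (1 - γ) * (t0 * α l + t1 * α (l + r) - t2 * pA) + γ * (t0 * α h + t1 * α (h + r) - t2 * P)
          = (1 - γ) * (t0 * α l + t1 * α (l + r)) + (γ * t0 * α h + γ * t1 * α (h + r) + 0 * (0:ℝ)) - (1 - γ) * t2 * pA - γ * t2 * P := by ring
      have eR : (1 - γ) * (t0 + t1) * (y / (1 - y)) * P + ((1 - γ) * t2 * pA + E * P) - (1 - γ) * t2 * pA - γ * t2 * P = 0 := by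
        rw [hE]; ring
      linarith only [two, low2, eL, eR]
    · -- kink at κh: bound both mins by u κh
      have m1 : min (κh * (y / (1 - y))) (y / (1 - y) * κh) ≤ y / (1 - y) * κh := min_le_right _ _
      have m2 : min (κ1 * (y / (1 - y))) (y / (1 - y) * κh) ≤ y / (1 - y) * κh := min_le_right _ _
      have k1 := kink κh hκh0 hκht
      have f1 := mul_le_mul_of_nonneg_left m1 (mul_nonneg hγ0 ht0p)
      have f2 := mul_le_mul_of_nonneg_left m2 (mul_nonneg hγ0 ht1p)
      have e : γ * t0 * (y / (1 - y) * κh) + γ * t1 * (y / (1 - y) * κh) = γ * (t0 + t1) * (y / (1 - y)) * κh := by ring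
      have e0 : (0:ℝ) * min (0 * (y / (1 - y))) (0 * κh) = 0 := by ring
      linarith only [f1, f2, k1, e, e0]
    · have m1 : min (κh * (y / (1 - y))) (y / (1 - y) * κ1) ≤ y / (1 - y) * κ1 := min_le_right _ _
      have m2 : min (κ1 * (y / (1 - y))) (y / (1 - y) * κ1) ≤ y / (1 - y) * κ1 := min_le_right _ _
      have k1 := kink κ1 hκ10 hκ1t
      have f1 := mul_le_mul_of_nonneg_left m1 (mul_nonneg hγ0 ht0p)
      have f2 := mul_le_mul_of_nonneg_left m2 (mul_nonneg hγ0 ht1p)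
      have e : γ * t0 * (y / (1 - y) * κ1) + γ * t1 * (y / (1 - y) * κ1) = γ * (t0 + t1) * (y / (1 - y)) * κ1 := by ring
      have e0 : (0:ℝ) * min (0 * (y / (1 - y))) (0 * κ1) = 0 := by ring
      linarith only [f1, f2, k1, e, e0]
    · have e1 : γ * t0 * min (κh * 0) ((y / (1 - y)) * 0) = 0 := by simp
      have e2 : γ * t1 * min (κ1 * 0) ((y / (1 - y)) * 0) = 0 := by simp
      have e3 : (0:ℝ) * min (0 * 0) (0 * (0:ℝ)) = 0 := by simp
      have e4 : (1 - γ) * t2 * 0 + E * 0 = 0 := by ring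
      linarith only [e1, e2, e3, e4]
  · -- h + r not low: its coefficient is −p(h+r) ≤ 0
    rw [cN (h + r) hH1]
    have two := GluedWindow.twoCol_dual_three (γ * t0) 0 0 κh 0 0 (y / (1 - y)) 0 0 (α h) 0 0
      ((1 - γ) * t2) E pA P (mul_nonneg hγ0 ht0p) le_rfl le_rfl hκh0 le_rfl le_rfl hu0 le_rfl le_rfl
      (mul_nonneg h1γ ht2p) hE0 hpA0 hP0 bhA (by simp) (by simp) bh (by simp) (by simp) ?_ ?_ ?_
    · have hpr := mul_nonneg (mul_nonneg hγ0 ht1p) (hp (h + r))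
      have eL : (1 - γ) * (t0 * α l + t1 * α (l + r) - t2 * pA) + γ * (t0 * α h + t1 * -p (h + r) - t2 * P)
          = (1 - γ) * (t0 * α l + t1 * α (l + r)) + (γ * t0 * α h + 0 * (0:ℝ) + 0 * (0:ℝ)) - γ * t1 * p (h + r) - (1 - γ) * t2 * pA - γ * t2 * P := by
        ring
      have eR : (1 - γ) * (t0 + t1) * (y / (1 - y)) * P + ((1 - γ) * t2 * pA + E * P) - (1 - γ) * t2 * pA - γ * t2 * P = 0 := by
        rw [hE]; ring
      linarith only [two, low2, eL, eR, hpr]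
    · have m1 : min (κh * (y / (1 - y))) (y / (1 - y) * κh) ≤ y / (1 - y) * κh := min_le_right _ _
      have k1 := kink κh hκh0 hκht
      have f1 := mul_le_mul_of_nonneg_left m1 (mul_nonneg hγ0 ht0p)
      have f3 : 0 ≤ γ * t1 * (y / (1 - y)) * κh := mul_nonneg (mul_nonneg (mul_nonneg hγ0 ht1p) hu0) hκh0
      have e : γ * t0 * (y / (1 - y) * κh) + γ * t1 * (y / (1 - y)) * κh = γ * (t0 + t1) * (y / (1 - y)) * κh := by ring
      have e0 : (0:ℝ) * min (0 * (y / (1 - y))) (0 * κh) = 0 := by ring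
      linarith only [f1, f3, k1, e, e0]
    · have e1 : γ * t0 * min (κh * 0) ((y / (1 - y)) * 0) = 0 := by simp
      have e3 : (0:ℝ) * min (0 * 0) (0 * (0:ℝ)) = 0 := by simp
      have e4 : (1 - γ) * t2 * 0 + E * 0 = 0 := by ring
      linarith only [e1, e3, e4]
    · have e1 : γ * t0 * min (κh * 0) ((y / (1 - y)) * 0) = 0 := by simp
      have e3 : (0:ℝ) * min (0 * 0) (0 * (0:ℝ)) = 0 := by simp
      have e4 : (1 - γ) * t2 * 0 + E * 0 = 0 := by ring
      linarith only [e1, e3, e4]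

end LawDec
end Quant
end Summit.CriticalPhenomena.PercolationContinuityZ3.Theorems
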